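import Summits.BirchSwinnertonDyer.Rank1Residual.X11b.BDPRoute
import Literature.NumberTheory.EllipticCurves.KrizLi2019.SexticTwistBSDThreeDescent
import Literature.NumberTheory.EllipticCurves.BSDHeegnerPointsGrossZagierProofs
import Literature.NumberTheory.EllipticCurves.KolyvaginShaIndexBound
import Literature.NumberTheory.EllipticCurves.Rank1Residual.PrintShape
import HarnessLib

/-!
# Class X11b, route "BDP + converse-theorem engine + Kolyvagin": the kernel theorems (cell `b2b-bsdres`, sub-cell `multr1-p2`)

HONEST FRAMING (cell `b2b-bsdres`, run/shared/lean/b2b/bsd-rank1-residual/, verbatim in every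
file): the goal of the cell is to DELETE the COMBINATION-SHAPED residual classes of the
Birch–Swinnerton-Dyer formula for ALL analytic-rank `≤ 1` elliptic curves over `ℚ` — "full BSD
formula for every rank `≤ 1` curve in class `C`" assembled STRICTLY from published theorems — so
that the rank-`≤ 1` remainder becomes exactly the CONSTRUCTION-SHAPED classes, which are TYPED
(missing-input `Prop`s), NOT attempted. This is not "finishing BSD". Sub-cell `multr1-p2` is a
RESEARCH ROUTE on class X11b (`ClassX11b W p := r_an = 1 ∧ p ≠ 2 ∧ mult(p) ∧ irr(p)`,
`Partition/Rows.lean`); no claim beyond the stated class and locus.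

THEOREMS ONLY (no definition, no new named fact). The route and the status of its one typed input
`X11b.IndexLowerBoundAt` (OPEN at `p ∥ N`) are documented in `X11b/BDPRoute.lean`. This file proves:

* `indexIdentityAt_of_lowerBound_of_kolyvagin` — STEP L (typed input) + STEP U (Kolyvagin 1990
  Thm. A as printed by McCallum 1991 / Gross 1991, tree NAMED FACTS `kolyvagin`,
  `Kolyvagin1990_padicValNat_card_sha_le`, PUBLISHED) ⇒ the Heegner-index identity over `K`
  (`X11b.IndexIdentityAt`) at every pair with `p ∤ ∏_ℓ c_ℓ(E/ℚ)`, `p` odd, `ρ̄_{E,p}` surjective.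
* `bsdp_of_indexIdentityAt` — THE DESCENT `K → ℚ` at an odd prime `p`: the identity over `K` +
  Gross–Zagier (`gross_zagier`) + Kolyvagin (`kolyvagin`) + Gross–Zagier–Kolyvagin over `ℚ`
  (`rank_eq_analyticRank_of_analyticRank_le_one`) + modularity (`hasEntireLFunction_rat`) + the
  rank-`0` `p`-part for a minimal model `Wd` of the twist `E^{d_K}` in the print shape of bsd.S30 /
  Skinner 2016 Thm. C + two decidable side conditions (`ord_p ∏c(Wd) = ord_p ∏c(W)`, `ord_p u(Cd) = 0`)
  + `p ∤ c(Dt)`, `p ∤ #𝓞_K^×` ⇒ Miller's `BSD(E,p)`. The bookkeeping is that of Jetchev–Skinner–Wan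
  2017 §7.4.1 ((eq:gz for K′), "`Ш(E/K)[p^∞] ≅ Ш(E/ℚ)[p^∞] ⊕ Ш(E^D/ℚ)[p^∞]`") and Gross–Zagier
  1986 V.§2, carried out EXACTLY as in `KrizLi2019/SexticTwistBSDThreeDescent.lean` (whose §1–§4
  lemmas are reused): Artin formalism, the period relation `‖ω‖²/√|D| = Ω(E)Ω(E^D)/[E(ℝ):E(ℝ)⁰]`,
  the height–index relation in rank one, the odd parts of `Ш` and of the torsion under base change.
The ASSEMBLY on class X11b (with Skinner 2016 Thm. C for the twist) is `X11b/BDPRouteAssembly.lean`.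
Nothing here is a class theorem free of the typed input.

References: [JetchevSkinnerWan2017] §7.4 (pp. 30–31); [Castella2018] (1.1), (5.2)–(5.3), §5;
[GrossZagier1986] V.§2; [KolyvaginEulerSystems1990] Thm. A; [McCallumLMS1991] §1; [GrossLMS1991]
Thm. 1.3; [Skinner2016PacificMC] Thm. C; [Miller2011LMS] Def. 1.1; [KrizLi2019] §10.3 (shape).
-/

noncomputable section

open scoped Classical

open WeierstrassCurve NumberField Literature.NumberTheory.EllipticCurves
  Literature.NumberTheory.EllipticCurves.ModularForms
  Literature.NumberTheory.EllipticCurves.Rank1Residual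
  Literature.NumberTheory.EllipticCurves.KrizLi2019
  Literature.NumberTheory.QuadraticFields

namespace Summit.BirchSwinnertonDyer.Rank1Residual.X11b

/-! ## §1. STEP L + STEP U ⇒ the index identity over `K` -/

/-- **Lower bound (typed input) + Kolyvagin's upper bound ⇒ the Heegner-index identity over `K`,
at a pair with `p ∤ ∏_ℓ c_ℓ(E/ℚ)`.** For an elliptic `W/ℚ`, an imaginary quadratic `K` with the
Heegner hypothesis for the level `N`, a Heegner point `P ∈ E(K)` of infinite order, and an odd prime
`p` with `ρ̄_{E,p}` surjective: Kolyvagin's bound (tree fact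
`Kolyvagin1990_padicValNat_card_sha_le` — `ord_p #Ш(E/K) ≤ 2·ord_p [E(K):ℤP]`, McCallum 1991 §1 /
Gross 1991 Thm. 1.3 (2), PUBLISHED; in the junk case `#Ш = 0` of an infinite `Ш` both sides read
with `ord_p 0 = 0`, and finiteness — Kolyvagin's `kolyvagin` — is used only downstream) and the typed STEP L
`2·ord_p [E(K):ℤP] ≤ ord_p #Ш(E/K) + 2·ord_p ∏_ℓ c_ℓ(E)` squeeze to the identity when
`ord_p ∏_ℓ c_ℓ(E) = 0`. This is Jetchev–Skinner–Wan 2017 §7.4.3 ("Combining (eq:shalower) and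
(eq:shaupper)") over `K` instead of `ℚ`. [cite: McCallumLMS1991, §1 Theorem (Kolyvagin), p. 296]
[cite: JetchevSkinnerWan2017, §7.4.1–7.4.3 (pp. 30–31)] -/
theorem indexIdentityAt_of_lowerBound_of_kolyvagin
    (W : WeierstrassCurve ℚ) [W.IsElliptic] (p : ℕ) [Fact p.Prime] {N : ℕ} [NeZero N]
    {K : Type} [Field K] [NumberField K]
    (hB : Kolyvagin1990_padicValNat_card_sha_le N W K)
    (hK : IsImaginaryQuadratic K) (hH : SatisfiesHeegnerHypothesis N K)
    {P : (W.baseChange K).toAffine.Point} (hP : IsHeegnerPoint N W K P) (hnt : ¬ IsOfFinAddOrder P)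
    (hp2 : p ≠ 2) (hρ : W.HasSurjectiveModNGaloisRep p) (htam : ¬ p ∣ W.tamagawaProduct)
    (hL : IndexLowerBoundAt W p K P) : IndexIdentityAt W p K P := by
  have hp : p.Prime := Fact.out
  have hle := hB hK hH hP hnt hp hp2 hρ
  have h0 : padicValNat p W.tamagawaProduct = 0 := padicValNat.eq_zero_of_not_dvd htam
  unfold IndexLowerBoundAt at hL
  unfold IndexIdentityAt
  rw [WeierstrassCurve.shaOrder] at hL ⊢
  omega

/-! ## §2. The descent `K → ℚ` at an odd prime `p` -/

/-- **`BSD(E,p)` over `ℚ` from the Heegner-index identity over `K`, Gross–Zagier, Kolyvagin and the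
rank-zero `p`-part of the twist — the descent of Jetchev–Skinner–Wan 2017 §7.4.1 / Castella 2018
§5 / Gross–Zagier 1986 V.§2, EXACT at an odd prime `p`.** Data: `W/ℚ` globally minimal of conductor
`N` with `ord_{s=1} L(E,s) = 1`; `K` imaginary quadratic with the Heegner hypothesis for `N` and
`L(E^{d_K}, 1) ≠ 0`; `P ∈ E(K)` the Heegner point of a parametrisation datum `Dt` whose Manin
constant is prime to `p` (`hc`); `p ∤ #𝓞_K^×` (`hμ`; automatic for `p ≥ 5`); `Wd = Cd • W^{(d_K)}`
a globally minimal model of the twist with `ord_p u(Cd) = 0` (`hu`) and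
`ord_p ∏_ℓ c_ℓ(Wd) = ord_p ∏_ℓ c_ℓ(W)` (`htam`: for `K` with every `ℓ ∣ N` split, `E^{d_K} ≅ E`
over `ℚ_ℓ` at `ℓ ∣ N` and `c_ℓ(E^{d_K}) ≤ 4` at the additive `ℓ ∣ d_K` — JSW 2017 (eq:tamK); a
decidable per-pair value, as in the Kriz–Li descent). PUBLISHED inputs as binders: `hGZ`
(Gross–Zagier 1986 / Cai–Shu–Tian 2014), `hKo` (Kolyvagin 1990 Thm. A), `hGZK` (Gross–Zagier–Kolyvagin
over `ℚ`, bsd.S17), `hmod` (modularity). The rank-`0` `p`-part of the twist enters in the print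
shape of bsd.S30 / Skinner 2016 Thm. C (`htw`: `L(E^D,1)/Ω_{E^D} = q_d`,
`ord_p q_d = ord_p #Ш(E^D) + ord_p ∏c_ℓ(E^D) − 2·ord_p #E^D(ℚ)_tors`). INPUT OVER `K`: the identity
`X11b.IndexIdentityAt W p K P` (granted finiteness of `Ш(E/K)`, which Kolyvagin supplies).
CONCLUSION: `BSDp W p`. Computation: `#Ш_an(E) = 8 I² t_W² / (n m t_K² c² w² q_d |u| c_W) ∈ ℚ` with
`I = [E(K):ℤP]`, `n = [E(ℝ):E(ℝ)⁰]`, `m ∈ {1,4}`, `w = #𝓞_K^×`, and `ord_p` of it equals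
`ord_p #Ш(E/ℚ)` by the identity, `t_K ~ t_W · t_d` and `Ш(E/K) ~ Ш(E) ⊕ Ш(E^D)` (odd parts).
[cite: JetchevSkinnerWan2017, §7.4.1 (eq:gz for K′), p. 30] [cite: GrossZagier1986, V.§2 (pp. 310–312)]
[cite: Castella2018, §5 (p. 12)] [cite: Miller2011LMS, Def. 1.1] -/
theorem bsdp_of_indexIdentityAt
    (W : WeierstrassCurve ℚ) [W.IsElliptic] [W.IsGloballyMinimal] (p : ℕ) [Fact p.Prime]
    (N : ℕ) [NeZero N] (K : Type) [Field K] [NumberField K]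
    (Dt : ModularParametrizationData W N) (H : HeegnerDatum N (NumberField.discr K)) (ι : K →+* ℂ)
    (P : (W.baseChange K).toAffine.Point)
    -- the published inputs (named facts of the tree)
    (hGZ : gross_zagier N W K) (hKo : kolyvagin N W K)
    (hGZK : rank_eq_analyticRank_of_analyticRank_le_one) (hmod : hasEntireLFunction_rat)
    -- the data
    (hK : IsImaginaryQuadratic K) (hHN : SatisfiesHeegnerHypothesis N K)
    (hP : WeierstrassCurve.Affine.Point.map ι.toRatAlgHom P = heegnerPointComplex Dt H)
    (hp2 : p ≠ 2) (hc : ¬ (p : ℤ) ∣ Dt.c) (hμ : ¬ p ∣ Units.torsionOrder K)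
    (hr : W.analyticRank = 1)
    (hLt : (W.quadraticTwist (NumberField.discr K : ℚ)).entireLFunction 1 ≠ 0)
    -- a globally minimal model of the quadratic twist by `d_K`
    (Wd : WeierstrassCurve ℚ) [Wd.IsElliptic] [Wd.IsGloballyMinimal] (Cd : VariableChange ℚ)
    (hWd : Cd • W.quadraticTwist (NumberField.discr K : ℚ) = Wd)
    -- the rank-zero `p`-part of the twist, print shape of bsd.S30 / Skinner 2016 Thm. C
    (htw : ∃ q : ℚ, Wd.entireLFunction 1 / (Wd.realPeriodRat : ℂ) = (q : ℂ) ∧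
      padicValRat p q = (padicValNat p Wd.shaOrder : ℤ) + padicValNat p Wd.tamagawaProduct -
        2 * padicValNat p Wd.torsionOrder)
    -- the two decidable side conditions
    (htam : padicValNat p Wd.tamagawaProduct = padicValNat p W.tamagawaProduct)
    (hu : padicValRat p (Cd.u : ℚ) = 0)
    -- the identity over `K`
    (hid : Finite (W.baseChange K).sha → IndexIdentityAt W p K P) :
    BSDp W p := by
  have hpp : p.Prime := Fact.out
  haveI hEK : (W.baseChange K).IsElliptic := isElliptic_baseChange' W K
  obtain ⟨h2, hKtc⟩ := hK
  haveI : IsTotallyComplex K := hKtc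
  have hD0 : (NumberField.discr K : ℚ) ≠ 0 := by exact_mod_cast NumberField.discr_ne_zero K
  haveI hEt : (W.quadraticTwist (NumberField.discr K : ℚ)).IsElliptic :=
    W.isElliptic_quadraticTwist hD0
  ---------------------------------------------------------------- `L`-values over `ℚ` and `K`
  have hL0 : W.entireLFunction 1 = 0 := entireLFunction_one_eq_zero_of_analyticRank_eq_one hr
  obtain ⟨hlead, hderiv⟩ := leadingLCoeff_eq_deriv_of_analyticRank_eq_one hr
  have hprod := lDerivEK_eq_deriv_mul W K hmod hL0
  have hLK : LDerivEK W K ≠ 0 := by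
    rw [hprod]; exact mul_ne_zero hderiv hLt
  ---------------------------------------------------------------- the Heegner point is non-torsion; Kolyvagin
  have hPH : IsHeegnerPoint N W K P := ⟨Dt, H, ι, hP⟩
  have hPinf : ¬ IsOfFinAddOrder P :=
    (lDerivEK_ne_zero_iff_not_isOfFinAddOrder W N K hGZ ⟨h2, hKtc⟩ hHN hPH).mp hLK
  obtain ⟨hrkK, hShaK⟩ := hKo ⟨h2, hKtc⟩ hHN hPH hPinf
  haveI hfinK : Finite (W.baseChange K).sha := hShaK
  have hKL := hid hfinK
  unfold IndexIdentityAt at hKL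
  have hShaW : W.ShaFinite := Literature.NumberTheory.EllipticCurves.shaFinite_of_baseChange W K hShaK
  haveI hfinW : Finite W.sha := hShaW
  ---------------------------------------------------------------- analytic ranks
  have hrt : (W.quadraticTwist (NumberField.discr K : ℚ)).analyticRank = 0 :=
    ((W.quadraticTwist _).analyticRank_eq_zero_iff_holds (hmod _)).2 hLt
  have hrd : Wd.analyticRank = 0 := by rw [← hWd, analyticRank_smul, hrt]
  ---------------------------------------------------------------- Gross–Zagier–Kolyvagin for `W` and `Wd`
  have hr1 : W.analyticRank ≤ 1 := le_of_eq hr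
  have hrQ : W.mordellWeilRank = 1 := by rw [(hGZK W hr1).1, hr]
  have hrd1 : Wd.analyticRank ≤ 1 := by omega
  obtain ⟨hrankd, hShad⟩ := hGZK Wd hrd1
  have hrkd : Wd.mordellWeilRank = 0 := by rw [hrankd, hrd]
  haveI hfind : Finite Wd.toAffine.Point := Wd.mordellWeilRank_eq_zero_iff_holds.mp hrkd
  haveI hfinSd : Finite Wd.sha := hShad
  have htdeq : Wd.torsionOrder = Nat.card Wd.toAffine.Point := Wd.torsionOrder_eq_natCard_of_finite
  ---------------------------------------------------------------- heights and index (Kriz–Li §2)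
  obtain ⟨m, hm, hheight⟩ :=
    exists_mul_canonicalHeight_eq_index_sq_mul_regulator W K h2 hrkK hrQ P hPinf
  ---------------------------------------------------------------- Gross–Zagier and the period
  have hLD := (hGZ ⟨h2, hKtc⟩ hHN) Dt H ι P hP
  have hper := two_mul_covolume_div_sqrt_eq_bsdPeriod W K Dt h2
  have hΩ := W.realPeriod_mul_realPeriod_quadraticTwist_eq_mul_bsdPeriod K h2
  have hΩd : Wd.realPeriodRat =
      |((Cd.u : ℚ) : ℝ)| * (W.quadraticTwist (NumberField.discr K : ℚ)).realPeriodRat := by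
    rw [← hWd]; exact realPeriodRat_smul_holds (W.quadraticTwist _) Cd
  have hLt' : (W.quadraticTwist (NumberField.discr K : ℚ)).entireLFunction = Wd.entireLFunction := by
    rw [← hWd, entireLFunction_smul]
  ---------------------------------------------------------------- the twist's `L`-value
  obtain ⟨qd, hqd, hvqd⟩ := htw
  have hΩdpos : 0 < Wd.realPeriodRat := Wd.realPeriodRat_pos_holds
  have hΩdC : (Wd.realPeriodRat : ℂ) ≠ 0 := by exact_mod_cast hΩdpos.ne'
  have hLd : Wd.entireLFunction 1 = (((qd : ℝ) * Wd.realPeriodRat : ℝ) : ℂ) := by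
    have := (div_eq_iff hΩdC).mp hqd
    rw [this]; push_cast; ring
  have hLd1 : Wd.entireLFunction 1 ≠ 0 := by rw [← hLt']; exact hLt
  have hqd0 : qd ≠ 0 := by
    intro h0
    apply hLd1
    rw [hLd, h0]; simp
  ---------------------------------------------------------------- positivity of everything
  have hΩW : 0 < W.realPeriodRat := W.realPeriodRat_pos_holds
  have hΩt : 0 < (W.quadraticTwist (NumberField.discr K : ℚ)).realPeriodRat :=
    (W.quadraticTwist _).realPeriodRat_pos_holds
  have hR : 0 < W.regulator := W.regulator_pos'
  have hcW : 0 < W.tamagawaProduct := W.tamagawaProduct_pos_holds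
  have hcd : 0 < Wd.tamagawaProduct := Wd.tamagawaProduct_pos_holds
  have htW : 0 < W.torsionOrder := W.torsionOrder_pos_holds
  have htK : 0 < (W.baseChange K).torsionOrder := (W.baseChange K).torsionOrder_pos_holds
  have htd : 0 < Nat.card Wd.toAffine.Point := Nat.card_pos
  have hSd : 0 < Wd.shaOrder := Wd.shaOrder_pos hShad
  have hcM : (Dt.c : ℚ) ≠ 0 := by
    have : Dt.c ≠ 0 := by rintro h0; exact hc (h0 ▸ dvd_zero (p : ℤ))
    exact_mod_cast this
  have hw : 0 < Units.torsionOrder K := Units.torsionOrder_pos K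
  have huu : (Cd.u : ℚ) ≠ 0 := Cd.u.ne_zero
  have hm0 : 0 < m := by rcases hm with rfl | rfl <;> norm_num
  have hI0 : (AddSubgroup.zmultiples P).index ≠ 0 := by
    intro hI
    rw [hI] at hheight
    have h0 : (m : ℝ) * ((W.baseChange K).torsionOrder : ℝ) ^ 2 * P.canonicalHeight = 0 := by
      rw [hheight]; simp
    have hh0 : P.canonicalHeight = 0 := by
      rcases mul_eq_zero.mp h0 with h' | h'
      · rcases mul_eq_zero.mp h' with h'' | h''
        · exact absurd (by exact_mod_cast h'' : m = 0) hm0.ne'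
        · exact absurd (pow_eq_zero_iff two_ne_zero |>.mp h'') (by exact_mod_cast htK.ne')
      · exact h'
    exact hPinf ((Affine.Point.canonicalHeight_eq_zero_iff_holds P).mp hh0)
  set n := (W.baseChange ℝ).numRealComponents with hn_def
  have hn : n = 1 ∨ n = 2 := numRealComponents_eq_one_or W
  have hn0 : 0 < n := by rcases hn with h' | h' <;> omega
  ---------------------------------------------------------------- the rational number `q = #Ш_an`
  set I := (AddSubgroup.zmultiples P).index with hI_def
  set q : ℚ := 8 * (I : ℚ) ^ 2 * (W.torsionOrder : ℚ) ^ 2 /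
      ((n : ℚ) * (m : ℚ) * ((W.baseChange K).torsionOrder : ℚ) ^ 2 * (Dt.c : ℚ) ^ 2 *
        (Units.torsionOrder K : ℚ) ^ 2 * qd * |(Cd.u : ℚ)| * (W.tamagawaProduct : ℚ)) with hq_def
  ---------------------------------------------------------------- real abbreviations
  set ΩW := W.realPeriodRat with hΩW_def
  set Ωt := (W.quadraticTwist (NumberField.discr K : ℚ)).realPeriodRat with hΩt_def
  set B := (W.baseChange K).bsdPeriod with hB_def
  set R := W.regulator with hR_def
  set hh := P.canonicalHeight with hhh_def
  set tK := (W.baseChange K).torsionOrder with htK_def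
  set tW := W.torsionOrder with htW_def
  set td := Nat.card Wd.toAffine.Point with htd_def
  set Sd := Wd.shaOrder with hSd_def
  set cdd := Wd.tamagawaProduct with hcdd_def
  set cW := W.tamagawaProduct with hcW_def
  set w := Units.torsionOrder K with hw_def
  set cM := Dt.c with hcM_def
  set u := (Cd.u : ℚ) with hu_def
  have hΩW' : ΩW = (W.baseChange ℝ).realPeriod := rfl
  have hΩt' : Ωt = ((W.quadraticTwist (NumberField.discr K : ℚ)).baseChange ℝ).realPeriod := rfl
  rw [← hΩW', ← hΩt'] at hΩ
  -- `B = ΩW Ωt / n`, `ĥ = 2 I² R / (m tK²)`, the Gross–Zagier constant `= 4 B / (c² w²)`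
  have hBeq : B = ΩW * Ωt / n := by
    rw [hΩ]; field_simp
  have hheq : hh = 2 * (I : ℝ) ^ 2 * R / ((m : ℝ) * (tK : ℝ) ^ 2) := by
    rw [← hheight]; field_simp
  have hGZc : 2 * ZLattice.covolume Dt.L.lattice /
        ((cM : ℝ) ^ 2 * ((w : ℝ) / 2) ^ 2 * √|(NumberField.discr K : ℝ)|) =
      4 * B / ((cM : ℝ) ^ 2 * (w : ℝ) ^ 2) := by
    rw [← hper]; field_simp; ring
  -- the `L`-values as real numbers
  have hLdr : Wd.entireLFunction 1 = (((qd : ℝ) * (|(u : ℝ)| * Ωt) : ℝ) : ℂ) := by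
    rw [hLd, hΩd]
  have hLdne : ((qd : ℝ) * (|(u : ℝ)| * Ωt) : ℝ) ≠ 0 := by
    have hu' : |(u : ℝ)| ≠ 0 := abs_ne_zero.mpr (by exact_mod_cast huu)
    have hqd' : (qd : ℝ) ≠ 0 := by exact_mod_cast hqd0
    exact mul_ne_zero hqd' (mul_ne_zero hu' hΩt.ne')
  set X : ℝ := (4 * B / ((cM : ℝ) ^ 2 * (w : ℝ) ^ 2) * hh) / ((qd : ℝ) * (|(u : ℝ)| * Ωt))
    with hX_def
  have hL1 : deriv W.entireLFunction 1 = ((X : ℝ) : ℂ) := by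
    have hne : ((((qd : ℝ) * (|(u : ℝ)| * Ωt) : ℝ)) : ℂ) ≠ 0 := by exact_mod_cast hLdne
    have key : deriv W.entireLFunction 1 * ((((qd : ℝ) * (|(u : ℝ)| * Ωt) : ℝ)) : ℂ) =
        ((4 * B / ((cM : ℝ) ^ 2 * (w : ℝ) ^ 2) * hh : ℝ) : ℂ) := by
      rw [← hLdr, ← hLt', ← hprod, hLD, hGZc]
    rw [hX_def, Complex.ofReal_div, ← key, mul_div_cancel_right₀ _ hne]
  have hshaAnR : shaAn W = ((X * (tW : ℝ) ^ 2 / (ΩW * (cW : ℝ) * R) : ℝ) : ℂ) := by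
    rw [shaAn_def, hlead, hL1]
    push_cast
    rfl
  have hXq : X * (tW : ℝ) ^ 2 / (ΩW * (cW : ℝ) * R) = (q : ℝ) := by
    have hn' : (n : ℝ) ≠ 0 := by exact_mod_cast hn0.ne'
    have hm' : (m : ℝ) ≠ 0 := by exact_mod_cast hm0.ne'
    have htK' : (tK : ℝ) ≠ 0 := by exact_mod_cast htK.ne'
    have htW' : (tW : ℝ) ≠ 0 := by exact_mod_cast htW.ne'
    have hcW' : (cW : ℝ) ≠ 0 := by exact_mod_cast hcW.ne'
    have hcM' : (cM : ℝ) ≠ 0 := by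
      exact_mod_cast (show cM ≠ 0 by rintro h0; exact hc (h0 ▸ dvd_zero (p : ℤ)))
    have hw' : (w : ℝ) ≠ 0 := by exact_mod_cast hw.ne'
    have hu' : |(u : ℝ)| ≠ 0 := abs_ne_zero.mpr (by exact_mod_cast huu)
    have hI' : (I : ℝ) ≠ 0 := by exact_mod_cast hI0
    have hqd' : (qd : ℝ) ≠ 0 := by exact_mod_cast hqd0
    rw [hX_def, hheq, hBeq, hq_def]
    push_cast
    field_simp
    ring
  have hshaAn : shaAn W = (q : ℂ) := by
    rw [hshaAnR, hXq]; norm_cast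
  ---------------------------------------------------------------- `p`-adic valuations
  -- torsion: `v_p(tK) = v_p(tW) + v_p(td)`
  obtain ⟨θ, c, hθ, hcθ⟩ := Quadratic.exists_sq_eq_algebraMap (F := ℚ) (K := K) h2
  obtain ⟨qq, hqq, hdq⟩ := NumberField.exists_discr_eq_mul_sq h2 hθ hcθ
  have htors : padicValNat p tK = padicValNat p tW + padicValNat p td :=
    padicValNat_torsionOrder_baseChange_quadratic W K h2 hθ hcθ hqq hdq ⟨Cd, hWd⟩ p hp2
  -- `Ш`: `v_p(S_K) = v_p(S_W) + v_p(S_d)`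
  have hsha : padicValNat p (W.baseChange K).shaOrder =
      padicValNat p W.shaOrder + padicValNat p Sd := by
    have hcard := card_primaryComponent_sha_baseChange_quadratic_of_odd_of_finite W K h2 Wd
      ⟨Cd, hWd⟩ (W.baseChange K) ⟨1, one_smul _ _⟩ p hp2
    rw [WeierstrassCurve.shaOrder, WeierstrassCurve.shaOrder, hSd_def, WeierstrassCurve.shaOrder,
      ← (Nat.pow_right_injective hpp.two_le).eq_iff, pow_add,
      ← natCard_primaryComponent_eq_pow_padicValNat p, ← natCard_primaryComponent_eq_pow_padicValNat p,
      ← natCard_primaryComponent_eq_pow_padicValNat p]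
    exact hcard
  have hshaW : Nat.card (AddCommGroup.primaryComponent W.sha p) = p ^ padicValNat p W.shaOrder :=
    natCard_primaryComponent_eq_pow_padicValNat p
  -- valuation of `q`
  have hI' : (I : ℚ) ≠ 0 := by exact_mod_cast hI0
  have htW' : (tW : ℚ) ≠ 0 := by exact_mod_cast htW.ne'
  have htK' : (tK : ℚ) ≠ 0 := by exact_mod_cast htK.ne'
  have hn' : (n : ℚ) ≠ 0 := by exact_mod_cast hn0.ne'
  have hm' : (m : ℚ) ≠ 0 := by exact_mod_cast hm0.ne'
  have hcW' : (cW : ℚ) ≠ 0 := by exact_mod_cast hcW.ne'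
  have hw' : (w : ℚ) ≠ 0 := by exact_mod_cast hw.ne'
  have hua : |u| ≠ 0 := abs_ne_zero.mpr huu
  have h8 : padicValRat p (8 : ℚ) = 0 := by
    rw [show (8 : ℚ) = ((8 : ℕ) : ℚ) by norm_num, padicValRat.of_nat]
    have : ¬ p ∣ 8 := by
      intro h
      have h' : p ∣ 2 ^ 3 := by simpa using h
      exact hp2 ((Nat.prime_dvd_prime_iff_eq hpp Nat.prime_two).mp (hpp.dvd_of_dvd_pow h'))
    simp [padicValNat.eq_zero_of_not_dvd this]
  have hvn : padicValRat p (n : ℚ) = 0 := by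
    rw [padicValRat.of_nat]
    have : ¬ p ∣ n := by
      rcases hn with h' | h'
      · rw [h']; exact hpp.one_lt.ne' ∘ Nat.dvd_one.mp
      · rw [h']; intro hd; exact hp2 ((Nat.prime_dvd_prime_iff_eq hpp Nat.prime_two).mp hd)
    simp [padicValNat.eq_zero_of_not_dvd this]
  have hvm : padicValRat p (m : ℚ) = 0 := by
    rw [padicValRat.of_nat]
    have : ¬ p ∣ m := by
      rcases hm with rfl | rfl
      · exact hpp.one_lt.ne' ∘ Nat.dvd_one.mp
      · intro hd
        have h' : p ∣ 2 ^ 2 := by simpa using hd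
        exact hp2 ((Nat.prime_dvd_prime_iff_eq hpp Nat.prime_two).mp (hpp.dvd_of_dvd_pow h'))
    simp [padicValNat.eq_zero_of_not_dvd this]
  have hvc : padicValRat p (cM : ℚ) = 0 := by
    rw [padicValRat.of_int, padicValInt.eq_zero_of_not_dvd hc]; rfl
  have hvw : padicValRat p (w : ℚ) = 0 := by
    rw [padicValRat.of_nat, padicValNat.eq_zero_of_not_dvd hμ]; rfl
  have hvu : padicValRat p |u| = 0 := by
    rcases abs_choice u with h' | h'
    · rw [h']; exact hu
    · rw [h', padicValRat.neg]; exact hu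
  have hvtd : padicValNat p Wd.torsionOrder = padicValNat p td := by rw [htdeq]
  have hval : padicValRat p q = padicValNat p (Nat.card (AddCommGroup.primaryComponent W.sha p)) := by
    -- nonvanishing of the partial products
    have hA1 : (8 : ℚ) * (I : ℚ) ^ 2 ≠ 0 := mul_ne_zero (by norm_num) (pow_ne_zero _ hI')
    have hA2 : (8 : ℚ) * (I : ℚ) ^ 2 * (tW : ℚ) ^ 2 ≠ 0 := mul_ne_zero hA1 (pow_ne_zero _ htW')
    have hD1 : (n : ℚ) * (m : ℚ) ≠ 0 := mul_ne_zero hn' hm'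
    have hD2 : (n : ℚ) * (m : ℚ) * (tK : ℚ) ^ 2 ≠ 0 := mul_ne_zero hD1 (pow_ne_zero _ htK')
    have hD3 : (n : ℚ) * (m : ℚ) * (tK : ℚ) ^ 2 * (cM : ℚ) ^ 2 ≠ 0 :=
      mul_ne_zero hD2 (pow_ne_zero _ hcM)
    have hD4 : (n : ℚ) * (m : ℚ) * (tK : ℚ) ^ 2 * (cM : ℚ) ^ 2 * (w : ℚ) ^ 2 ≠ 0 :=
      mul_ne_zero hD3 (pow_ne_zero _ hw')
    have hD5 : (n : ℚ) * (m : ℚ) * (tK : ℚ) ^ 2 * (cM : ℚ) ^ 2 * (w : ℚ) ^ 2 * qd ≠ 0 :=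
      mul_ne_zero hD4 hqd0
    have hD6 : (n : ℚ) * (m : ℚ) * (tK : ℚ) ^ 2 * (cM : ℚ) ^ 2 * (w : ℚ) ^ 2 * qd * |u| ≠ 0 :=
      mul_ne_zero hD5 hua
    have hD7 : (n : ℚ) * (m : ℚ) * (tK : ℚ) ^ 2 * (cM : ℚ) ^ 2 * (w : ℚ) ^ 2 * qd * |u| *
        (cW : ℚ) ≠ 0 := mul_ne_zero hD6 hcW'
    have hnum : padicValRat p ((8 : ℚ) * (I : ℚ) ^ 2 * (tW : ℚ) ^ 2) =
        2 * padicValNat p I + 2 * padicValNat p tW := by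
      rw [padicValRat.mul hA1 (pow_ne_zero _ htW'), padicValRat.mul (by norm_num) (pow_ne_zero _ hI'),
        padicValRat.pow, padicValRat.pow, h8, padicValRat.of_nat, padicValRat.of_nat]
      push_cast; ring
    have hden : padicValRat p ((n : ℚ) * (m : ℚ) * (tK : ℚ) ^ 2 * (cM : ℚ) ^ 2 * (w : ℚ) ^ 2 *
        qd * |u| * (cW : ℚ)) =
        2 * padicValNat p tK + padicValRat p qd + padicValNat p cW := by
      rw [padicValRat.mul hD6 hcW', padicValRat.mul hD5 hua, padicValRat.mul hD4 hqd0,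
        padicValRat.mul hD3 (pow_ne_zero _ hw'), padicValRat.mul hD2 (pow_ne_zero _ hcM),
        padicValRat.mul hD1 (pow_ne_zero _ htK'), padicValRat.mul hn' hm', padicValRat.pow,
        padicValRat.pow, padicValRat.pow, hvn, hvm, hvc, hvw, hvu, padicValRat.of_nat,
        padicValRat.of_nat]
      push_cast; ring
    rw [hshaW, padicValNat.prime_pow, hq_def, padicValRat.div hA2 hD7, hnum, hden, hvqd, hvtd]
    have e1 := hKL
    have e2 := htors
    have e3 := hsha
    have e4 := htam
    omega
  refine ⟨by rw [hrQ, hr], inferInstance, q, hshaAn, hval⟩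

end Summit.BirchSwinnertonDyer.Rank1Residual.X11b

end
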